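import Mathlib
import Summits.ResolutionOfSingularities.ResolutionOfSingularities.Theorems.WeightedInvariantLocalWeightedDropNCGameRank
import Summits.ResolutionOfSingularities.ResolutionOfSingularities.Theorems.WeightedInvariantLocalWeightedDropPolyDescentBridgeSlices
import Summits.ResolutionOfSingularities.ResolutionOfSingularities.Theorems.WeightedInvariantLocalWeightedDropMonicPointBlowup
import Summits.ResolutionOfSingularities.ResolutionOfSingularities.Theorems.WeightedInvariantLocalWeightedDropMonomialPhaseChart
import Summits.ResolutionOfSingularities.ResolutionOfSingularities.Theorems.WeightedInvariantGlobalizeLocalDropCylinder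
import Literature.AlgebraicGeometry.Resolution.CobordantArcLemma

/-!
# `WeightedInvariant.LocalWeightedDrop`, TOT2-LINE piece S-E2′ (the count-game bridge), part 1a: MONIC REPRESENTATIONS of NC-game positions,
# the chart factorisation of a represented position, and free re-centrings

Crux item stmt-ResolutionOfSingularities-8899 `LocalWeightedDrop` (route `ResolutionOfSingularities/WeightedInvariant`), ENGINE skeleton v32
(ddb48572591139d5), registered stub `stub_spaceNCRankDrop`; TOT2-LINE v1.1 §(E) piece S-E2′ (`L/res-L1-w43-lead-1/g4/TOT2-LINE.md`).
[OURS · L1 W4.3 · chain w43 · lead-1 gen 4.  Port of the point half of the weighted-game bridge (ρ-B) of the line «monic polyhedron descent»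
(res-D-pv-058 AS stub-6 / res-type-061: …PolyDescentBridgeSlices; stub worker 3's brick …MonicPointBlowup) from `CobordantGame` successors to the
successors of the NC count game (`TameFourTupleDrop.MoveClause`, res-type-056).  MODEL: Cossart–Jannsen–Saito LNM 2270 §11 Case 1 (point blow-up,
near points on the line `ℙ(Dir)`, Lemmas 11.1/11.2); Perlega arXiv:2011.14443 §7.1 (apposite parameters).  Nothing here is a statement of any
manuscript; the games are the programme's own.  AI-produced, gate-checked, weaker than expert review.]

* `NCPoly.monicGerm d A` — the monic germ `y^d + Σ_{j<d} A_j(u₁,u₂) y^j ∈ k⟦u₁,u₂,y⟧` of a label `A : Fin d → k⟦u₁,u₂⟧` (`y = X (Fin.last 2)`);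
* `NCPoly.bdry N` — the product of the COORDINATE boundary planes `u_l = 0`, `l ∈ N ⊆ Fin 2`;
* `NCPoly.Represents b d A N` — the NC-game position `b ∈ k⟦x₀,x₁,x₂⟧` IS, in some legal formal coordinates and up to a unit, the monic germ of the
  label `A` times the boundary planes `N`: the decorated states of the regime «e = 2» of the TOT2-LINE (the germ `f̃ = f · ∏(old components)` of the
  I₃-device together with its new boundary);
* `NCPoly.IsStdNC b`, `IsStdNC.germIsNC` — unit × monomial in the GIVEN coordinates (⇒ `GermIsNC`), closed under products;
* `NCPoly.gZero`, `NCPoly.planes`, **`NCPoly.chart_factorisation`** — at an exceptional point `pt` of the point blow-up the transform of a represented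
  position is `s^{d+|N|} · (U′ · g₀ · planes)` with `U′` a unit, `g₀` the strict transform of the monic germ (`MonicPointBlowup.transform_monic`) and
  `planes = ∏ (c_l + y′_l)`; any `s`-saturation `s^A · G`, `s ∤ G`, has `A = d + |N|`, `G = U′ · g₀ · planes`;
* `NCPoly.recentre`, **`NCPoly.Represents.shift`** — re-centring `y ↦ y + φ(u)` is free: a represented label may be replaced by any `WildMonic.shift d A φ`,
  `φ(0) = 0` (in particular by its preparation), same boundary.
-/

set_option linter.dupNamespace false -- mandated namespace of this single-conjunct summit

noncomputable section

namespace Summit.ResolutionOfSingularities.ResolutionOfSingularities.Theorems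

namespace NCPoly

open MvPowerSeries Literature.AlgebraicGeometry.Resolution TameFourTupleDrop

variable {k : Type} [Field k]

/-! ## Monic germs, coordinate boundaries, representations -/

/-- The MONIC GERM `y^d + Σ_{j<d} A_j y^j` of a label `A : Fin d → k⟦u₁,u₂⟧`, `y = X (Fin.last 2)` (the shape of every `PolyDescent` file). -/
def monicGerm (d : ℕ) (A : Fin d → MvPowerSeries (Fin 2) k) : MvPowerSeries (Fin 3) k :=
  X (Fin.last 2) ^ d + ∑ j : Fin d, rename (Fin.succAboveEmb (Fin.last 2)) (A j) * X (Fin.last 2) ^ (j : ℕ)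

/-- The product of the COORDINATE BOUNDARY PLANES `u_l = 0`, `l ∈ N`. -/
def bdry (N : Finset (Fin 2)) : MvPowerSeries (Fin 3) k :=
  ∏ l ∈ N, X (Fin.castSucc l)

/-- `b` REPRESENTS the label `A` (degree `d`) with coordinate boundary `N`: in some legal formal coordinates `Θ` (zero constant terms, invertible
linear part) and up to a unit `U`, `b ∘ Θ = U · (y^d + Σ A_j y^j) · ∏_{l ∈ N} u_l`. -/
def Represents (b : MvPowerSeries (Fin 3) k) (d : ℕ) (A : Fin d → MvPowerSeries (Fin 2) k) (N : Finset (Fin 2)) : Prop :=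
  ∃ (Θ : Fin 3 → MvPowerSeries (Fin 3) k) (U : MvPowerSeries (Fin 3) k),
    (∀ i, constantCoeff (Θ i) = 0) ∧ IsUnit (Matrix.det (Matrix.of fun i j => coeff (Finsupp.single j 1) (Θ i))) ∧
    constantCoeff U ≠ 0 ∧ subst Θ b = U * monicGerm d A * bdry N

/-- UNIT × MONOMIAL in the given coordinates. -/
def IsStdNC {n : ℕ} (b : MvPowerSeries (Fin n) k) : Prop :=
  ∃ (u : MvPowerSeries (Fin n) k) (e : Fin n → ℕ), constantCoeff u ≠ 0 ∧ b = u * ∏ i, X i ^ e i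

/-- Unit × monomial is a normal crossing (identity coordinates). -/
theorem IsStdNC.germIsNC {n : ℕ} {b : MvPowerSeries (Fin n) k} (h : IsStdNC b) : GermIsNC b := by
  obtain ⟨u, e, hu, hb⟩ := h
  refine ⟨X, u, e, fun i => constantCoeff_X i, ?_, hu, ?_⟩
  · have hM : (Matrix.of fun i j => coeff (Finsupp.single j 1) ((X : Fin n → MvPowerSeries (Fin n) k) i)) = 1 := by
      ext i j
      simp only [Matrix.of_apply, coeff_X, Finsupp.single_eq_single_iff, one_ne_zero, and_true, and_self, or_false,
        Matrix.one_apply]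
      by_cases h : i = j
      · subst h; simp
      · rw [if_neg (fun h' => h h'.symm), if_neg h]
    rw [hM, Matrix.det_one]
    exact isUnit_one
  · rw [subst_self]
    exact hb

/-- A unit is unit × (empty monomial). -/
theorem IsStdNC.of_unit {n : ℕ} {u : MvPowerSeries (Fin n) k} (hu : constantCoeff u ≠ 0) : IsStdNC u :=
  ⟨u, 0, hu, by simp⟩

/-- A variable is unit × monomial. -/
theorem isStdNC_X {n : ℕ} (i : Fin n) : IsStdNC (X i : MvPowerSeries (Fin n) k) := by
  classical
  refine ⟨1, Pi.single i 1, by rw [constantCoeff_one]; exact one_ne_zero, ?_⟩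
  rw [one_mul, Finset.prod_eq_single i (fun j _ hj => by rw [Pi.single_eq_of_ne hj, pow_zero])
    (fun h => absurd (Finset.mem_univ i) h), Pi.single_eq_same, pow_one]

/-- Products of unit × monomial are unit × monomial. -/
theorem IsStdNC.mul {n : ℕ} {b b' : MvPowerSeries (Fin n) k} (h : IsStdNC b) (h' : IsStdNC b') : IsStdNC (b * b') := by
  obtain ⟨u, e, hu, rfl⟩ := h
  obtain ⟨u', e', hu', rfl⟩ := h'
  refine ⟨u * u', e + e', by rw [map_mul]; exact mul_ne_zero hu hu', ?_⟩
  have hprod : (∏ i, X i ^ (e + e') i : MvPowerSeries (Fin n) k) = (∏ i, X i ^ e i) * ∏ i, X i ^ e' i := by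
    rw [← Finset.prod_mul_distrib]; exact Finset.prod_congr rfl fun i _ => by rw [Pi.add_apply, pow_add]
  rw [hprod]
  ring

/-- Finite products of unit × monomial are unit × monomial. -/
theorem IsStdNC.prod {n : ℕ} {ι : Type*} (s : Finset ι) (f : ι → MvPowerSeries (Fin n) k) (h : ∀ i ∈ s, IsStdNC (f i)) :
    IsStdNC (∏ i ∈ s, f i) := by
  classical
  induction s using Finset.induction_on with
  | empty => rw [Finset.prod_empty]; exact IsStdNC.of_unit (by rw [constantCoeff_one]; exact one_ne_zero)
  | insert a s ha ih =>
    rw [Finset.prod_insert ha]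
    exact (h a (Finset.mem_insert_self a s)).mul (ih fun i hi => h i (Finset.mem_insert_of_mem hi))

/-- `C a + X j` is unit × monomial: a unit when `a ≠ 0`, the variable when `a = 0`. -/
theorem isStdNC_C_add_X {n : ℕ} (a : k) (j : Fin n) : IsStdNC (C a + X j : MvPowerSeries (Fin n) k) := by
  by_cases ha : a = 0
  · rw [ha, map_zero, zero_add]; exact isStdNC_X j
  · exact IsStdNC.of_unit (by rw [map_add, constantCoeff_C, constantCoeff_X, add_zero]; exact ha)

/-! ## The point blow-up chart of a represented position -/

/-- The strict transform `g₀ = (γ + y′)^d + s · Σ_j B_j (γ + y′)^j` of the monic germ at the exceptional point `pt = (c₀, c₁, γ)` (the shape of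
`MonicPointBlowup.transform_monic` at `m = 2`). -/
def gZero (d : ℕ) (γ : k) (B : Fin d → MvPowerSeries (Fin 3) k) : MvPowerSeries (Fin 4) k :=
  (C γ + X (Fin.last 3)) ^ d + X 0 * ∑ j : Fin d, rename (Fin.succAboveEmb (Fin.last 3)) (B j) * (C γ + X (Fin.last 3)) ^ (j : ℕ)

/-- The constant coefficient of `gZero` is `γ^d`. -/
theorem constantCoeff_gZero (d : ℕ) (γ : k) (B : Fin d → MvPowerSeries (Fin 3) k) : constantCoeff (gZero d γ B) = γ ^ d :=
  MonicPointBlowup.constantCoeff_g₀ (m := 2) d γ _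

/-- `s ∤ gZero` (the `y′^d` coefficient is `1`). -/
theorem not_X_dvd_gZero (d : ℕ) (γ : k) (B : Fin d → MvPowerSeries (Fin 3) k) : ¬ X (0 : Fin 4) ∣ gZero d γ B := fun h => by
  have h1 := MonicPointBlowup.coeff_top_g₀ (m := 2) d γ
    (∑ j : Fin d, rename (Fin.succAboveEmb (Fin.last 3)) (B j) * (C γ + X (Fin.last 3)) ^ (j : ℕ))
  rw [gZero] at h
  rw [X_dvd_iff.mp h _ (by rw [Finsupp.single_apply, if_neg Fin.last_pos.ne'])] at h1
  exact zero_ne_one h1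

/-- The product of the transformed boundary planes `∏_{l ∈ N} (c_l + y′_l)`. -/
def planes (N : Finset (Fin 2)) (pt : Fin 3 → k) : MvPowerSeries (Fin 4) k :=
  ∏ l ∈ N, (C (pt (Fin.castSucc l)) + X (Fin.castSucc l).succ)

/-- `s` does not divide `C a + X j` for `j ≠ 0`. -/
theorem not_X_zero_dvd_C_add_X {n : ℕ} (a : k) {j : Fin (n + 1)} (hj : j ≠ 0) : ¬ X (0 : Fin (n + 1)) ∣ (C a + X j) := fun h => by
  have h1 : coeff (Finsupp.single j 1) (C a + X j : MvPowerSeries (Fin (n + 1)) k) = 1 := by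
    rw [map_add, coeff_C, if_neg (Finsupp.single_ne_zero.mpr one_ne_zero), coeff_X, if_pos rfl, zero_add]
  rw [X_dvd_iff.mp h _ (by rw [Finsupp.single_apply, if_neg hj])] at h1
  exact zero_ne_one h1

/-- `s ∤ planes`. -/
theorem not_X_dvd_planes (N : Finset (Fin 2)) (pt : Fin 3 → k) : ¬ X (0 : Fin 4) ∣ planes N pt := by
  classical
  unfold planes
  induction N using Finset.induction_on with
  | empty =>
    rw [Finset.prod_empty]
    exact fun h => (MvPowerSeries.prime_X' k (0 : Fin 4)).not_dvd_one h
  | insert a s ha ih =>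
    rw [Finset.prod_insert ha]
    exact fun h => ((MvPowerSeries.prime_X' k (0 : Fin 4)).dvd_or_dvd h).elim
      (not_X_zero_dvd_C_add_X _ (Fin.succ_ne_zero _)) ih

/-- The chart image of the boundary: `bdry N ∘ chart = s^{|N|} · planes`. -/
theorem subst_chart_bdry (N : Finset (Fin 2)) (pt : Fin 3 → k) :
    subst (CobordantChart.chart (fun _ : Fin 3 => 1) pt) (bdry N : MvPowerSeries (Fin 3) k) = X 0 ^ N.card * planes N pt := by
  classical
  have hch := CobordantChart.hasSubst_chart (fun _ : Fin 3 => 1) pt (fun _ hi => absurd hi one_ne_zero)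
  unfold bdry planes
  rw [← coe_substAlgHom hch, map_prod]
  simp only [coe_substAlgHom, subst_X hch, CobordantChart.chart_apply, pow_one]
  rw [Finset.prod_mul_distrib, Finset.prod_const]

/-- A unit stays a unit under the chart (constant terms are preserved). -/
theorem constantCoeff_subst_chart_eq (pt : Fin 3 → k) (U : MvPowerSeries (Fin 3) k) :
    constantCoeff (subst (CobordantChart.chart (fun _ : Fin 3 => 1) pt) U) = constantCoeff U :=
  constantCoeff_subst_of_constantCoeff_zero _ (CobordantArc.constantCoeff_chart (fun _ : Fin 3 => 1) pt
    (fun _ hi => absurd hi one_ne_zero)) U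

/-- A series with non-zero constant term is not divisible by `s`. -/
theorem not_X_dvd_of_constantCoeff_ne_zero {n : ℕ} {V : MvPowerSeries (Fin (n + 1)) k} (hV : constantCoeff V ≠ 0) :
    ¬ X (0 : Fin (n + 1)) ∣ V := fun h => hV (by
  rw [← coeff_zero_eq_constantCoeff_apply]
  exact X_dvd_iff.mp h 0 (by simp))

/-- **THE CHART FACTORISATION.**  If `b ∘ Θ = U · monicGerm A · bdry N` with `A` positive, then at an exceptional point `pt` of the point blow-up
the `s`-saturation of the transform is `b(Θ)(chart_pt) = s^{d + |N|} · (U′ · g₀ · planes)` with `U′ = U ∘ chart` a unit, `g₀` the strict transform of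
the monic germ (`MonicPointBlowup.transform_monic`) and `planes` the transformed boundary; given any factorisation `s^A · G`, `s ∤ G`, of the same
series, `A = d + |N|` and `G = U′ · g₀ · planes`. -/
theorem chart_factorisation {d : ℕ} {A : Fin d → MvPowerSeries (Fin 2) k} (hA : PolyDescent.IsPosT d A)
    {b U : MvPowerSeries (Fin 3) k} {Θ : Fin 3 → MvPowerSeries (Fin 3) k} {N : Finset (Fin 2)}
    (hU : constantCoeff U ≠ 0) (hb : subst Θ b = U * monicGerm d A * bdry N) (pt : Fin 3 → k) {Aexp : ℕ} {G : MvPowerSeries (Fin 4) k}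
    (hfac : subst (CobordantChart.chart (fun _ : Fin 3 => 1) pt) (subst Θ b) = X 0 ^ Aexp * G) (hG : ¬ X (0 : Fin 4) ∣ G) :
    ∃ B : Fin d → MvPowerSeries (Fin 3) k,
      (∀ j, subst (CobordantChart.chart (fun _ : Fin 2 => 1) (fun l => pt (Fin.castSucc l))) (A j) = X 0 ^ (d - (j : ℕ) + 1) * B j) ∧
      Aexp = d + N.card ∧
      G = subst (CobordantChart.chart (fun _ : Fin 3 => 1) pt) U * gZero d (pt (Fin.last 2)) B * planes N pt := by
  classical
  -- the factorisations `A_j ∘ chart(c) = s^{d-j+1} B_j`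
  have hBex : ∀ j : Fin d, ∃ Bj : MvPowerSeries (Fin 3) k,
      subst (CobordantChart.chart (fun _ : Fin 2 => 1) (fun l => pt (Fin.castSucc l))) (A j) = X 0 ^ (d - (j : ℕ) + 1) * Bj :=
    fun j => MonicPointBlowup.exists_eq_X_pow_mul_of_le_order _ (A j) _ (Order.add_one_le_of_lt (hA j))
  choose B hB using hBex
  refine ⟨B, hB, ?_⟩
  have hch := CobordantChart.hasSubst_chart (fun _ : Fin 3 => 1) pt (fun _ hi => absurd hi one_ne_zero)
  -- the monic germ: `transform_monic`
  have hT : subst (CobordantChart.chart (fun _ : Fin 3 => 1) pt) (monicGerm d A) = X 0 ^ d * gZero d (pt (Fin.last 2)) B := by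
    rw [← MonicPointBlowup.cruxChart_one_eq_chart pt, monicGerm, MonicPointBlowup.transform_monic A pt B hB]
    rfl
  -- assemble
  have hlhs : subst (CobordantChart.chart (fun _ : Fin 3 => 1) pt) (subst Θ b) =
      X 0 ^ (d + N.card) * (subst (CobordantChart.chart (fun _ : Fin 3 => 1) pt) U * gZero d (pt (Fin.last 2)) B * planes N pt) := by
    rw [hb, ← coe_substAlgHom hch, map_mul, map_mul, coe_substAlgHom, hT, subst_chart_bdry]
    ring
  have hne : ¬ X (0 : Fin 4) ∣ subst (CobordantChart.chart (fun _ : Fin 3 => 1) pt) U * gZero d (pt (Fin.last 2)) B * planes N pt := by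
    have hp := MvPowerSeries.prime_X' k (0 : Fin 4)
    intro h
    rcases hp.dvd_or_dvd h with h | h
    · rcases hp.dvd_or_dvd h with h | h
      · exact not_X_dvd_of_constantCoeff_ne_zero (by rw [constantCoeff_subst_chart_eq]; exact hU) h
      · exact not_X_dvd_gZero _ _ _ h
    · exact not_X_dvd_planes _ _ h
  · rw [hlhs] at hfac
    obtain ⟨hA', hG'⟩ := X_pow_mul_eq_X_pow_mul 0 hfac hne hG
    exact ⟨hA'.symm, hG'.symm⟩


/-! ## Re-centring `y ↦ y + φ(u)` is free: a represented label may be replaced by any shift -/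

/-- The re-centring `y ↦ y + φ(u₁,u₂)` (planes fixed). -/
def recentre (φ : MvPowerSeries (Fin 2) k) : Fin 3 → MvPowerSeries (Fin 3) k :=
  fun l => if l = Fin.last 2 then X (Fin.last 2) + rename (Fin.succAboveEmb (Fin.last 2)) φ else X l

/-- Its value on `y`. -/
theorem recentre_last (φ : MvPowerSeries (Fin 2) k) :
    recentre φ (Fin.last 2) = X (Fin.last 2) + rename (Fin.succAboveEmb (Fin.last 2)) φ := if_pos rfl

/-- Its value on the planes. -/
theorem recentre_of_ne (φ : MvPowerSeries (Fin 2) k) {l : Fin 3} (hl : l ≠ Fin.last 2) : recentre φ l = X l := if_neg hl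

/-- Zero constant terms (`φ(0) = 0`). -/
theorem constantCoeff_recentre {φ : MvPowerSeries (Fin 2) k} (hφ : constantCoeff φ = 0) (l : Fin 3) :
    constantCoeff (recentre φ l) = 0 := by
  by_cases hl : l = Fin.last 2
  · rw [hl, recentre_last, map_add, constantCoeff_X, constantCoeff_rename, hφ, add_zero]
  · rw [recentre_of_ne φ hl]; exact constantCoeff_X l

/-- Invertible (unipotent) linear part. -/
theorem isUnit_det_linMat_recentre (φ : MvPowerSeries (Fin 2) k) : IsUnit (FormalCoordChange.linMat (recentre φ)).det := by
  have hc1 : coeff (Finsupp.single (Fin.last 2) 1) (rename (Fin.succAboveEmb (Fin.last 2)) φ) = 0 := by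
    have h := TschirnhausForm.coeff_emb_add_single_rename (m := 2) (0 : Fin 2 →₀ ℕ) 1 φ
    rw [Finsupp.embDomain_zero, zero_add, if_neg one_ne_zero] at h
    exact h
  rw [FormalCoordChange.linMat, TschirnhausForm.det_of_offLast_rows]
  · rw [Matrix.of_apply, recentre_last, map_add, coeff_index_single_self_X, hc1, add_zero]
    exact isUnit_one
  · intro l j hl
    rw [Matrix.of_apply, recentre_of_ne φ hl, coeff_index_single_X]

/-- Action on monic germs: `monicGerm d A ↦ monicGerm d (shift d A φ)` (`WildMonic.subst_shear_monicForm`). -/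
theorem subst_recentre_monicGerm {φ : MvPowerSeries (Fin 2) k} (hφ : constantCoeff φ = 0) (d : ℕ) (A : Fin d → MvPowerSeries (Fin 2) k) :
    subst (recentre φ) (monicGerm d A) = monicGerm d (WildMonic.shift d A φ) :=
  WildMonic.subst_shear_monicForm (m := 2) φ hφ A

/-- The planes are fixed. -/
theorem subst_recentre_bdry {φ : MvPowerSeries (Fin 2) k} (hφ : constantCoeff φ = 0) (N : Finset (Fin 2)) :
    subst (recentre φ) (bdry N : MvPowerSeries (Fin 3) k) = bdry N := by
  have hs := hasSubst_of_constantCoeff_zero (constantCoeff_recentre hφ)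
  unfold bdry
  rw [← coe_substAlgHom hs, map_prod]
  exact Finset.prod_congr rfl fun l _ => by rw [coe_substAlgHom, subst_X hs, recentre_of_ne φ (Fin.castSucc_lt_last l).ne]

/-- **RE-CENTRING IS FREE**: if `b` represents `A` with boundary `N`, it represents every shift `shift d A φ`, `φ(0) = 0`, with the same boundary
(compose the representing coordinates with `y ↦ y + φ`).  In particular a represented label may be replaced by its preparation. -/
theorem Represents.shift {b : MvPowerSeries (Fin 3) k} {d : ℕ} {A : Fin d → MvPowerSeries (Fin 2) k} {N : Finset (Fin 2)}
    (h : Represents b d A N) {φ : MvPowerSeries (Fin 2) k} (hφ : constantCoeff φ = 0) : Represents b d (WildMonic.shift d A φ) N := by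
  obtain ⟨Θ, U, hΘ0, hdet, hU, hb⟩ := h
  have hρ0 := constantCoeff_recentre hφ
  have hρs := hasSubst_of_constantCoeff_zero hρ0
  refine ⟨fun i => subst (recentre φ) (Θ i), subst (recentre φ) U, fun i => constantCoeff_comp_eq_zero hΘ0 hρ0 i, ?_, ?_, ?_⟩
  · change IsUnit (FormalCoordChange.linMat (fun i => subst (recentre φ) (Θ i))).det
    rw [linMat_comp Θ hρ0, Matrix.det_mul]
    exact hdet.mul (isUnit_det_linMat_recentre φ)
  · rw [constantCoeff_subst_of_constantCoeff_zero _ hρ0]; exact hU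
  · rw [← subst_subst_eq_subst_comp hΘ0 hρ0, hb, ← coe_substAlgHom hρs, map_mul, map_mul, coe_substAlgHom,
      subst_recentre_monicGerm hφ, subst_recentre_bdry hφ]

end NCPoly

end Summit.ResolutionOfSingularities.ResolutionOfSingularities.Theorems

end
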